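import Summits.BirchSwinnertonDyer.Rank1Residual.X2.SplitHalvesAssembly
import Summits.BirchSwinnertonDyer.Rank1Residual.X2.HidaLimitRoadInt
import HarnessLib

/-!
# O9 ∩ {SPLIT} over the WIDE receptacle `𝓞_{ℂ_p}⟦T⟧`: the split halves re-typed ♭ and the split road
# assembled WITHOUT the residual c1s (cell `bsd-eis`, seat `bsd-eis-cgshw` g8; route `EisensteinPrimes`,
# crux 4 `BSDpOnCellC` = stmt-BirchSwinnertonDyer-19034, line b1: reshape v3 → v4 — the split twin of
# k5-c4's `X2/NonsplitBDPExistsInt.lean` p418462 / `X2/NonsplitHalvesOnTreeInt.lean` p420477 and the ♭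
# twin of cgshw g6's `X2/SplitHalvesOnTree.lean` p416318 / `X2/SplitHalvesAssembly.lean`)

HONEST FRAMING (cell `bsd-eis`): four hypothesis-shaped `@[conjecture]` predicates + theorems; nothing
asserted or booked; X2 stays CONSTRUCTION-SHAPED; no label or count moves. No registered stub is renamed:
this file supplies the SPLIT-sign statements over the wide receptacle so the skeleton can drop `stub_c1_split`.

## Why

cgshw g6 typed the split road over `R₀`-frames (c1s `SplitHsiehFrameResidualAt`, c2s, c3s, CTL-split;
`X2/SplitHalvesOnTree.lean`); k5-c4 moved the NON-split road to the wide receptacle, where Hsieh 2014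
Thm. 1 supplies a frame at EVERY X2 datum, EITHER sign (`exists_isBDPLFunctionInt_of_hsieh2014_of_classX2`,
p418462), so the residual c1 disappears. g6's pointwise assembly with (CTL) as a hypothesis and the
receptacle's `X11b.R1.imcWaldspurgerOnTreeAt_of_intHalves` are sign-free, so the SPLIT road runs over
the wide receptacle with NO c1s:

* §1 `SplitBDPValueOnTreeInt` (c2s♭), `SplitIMCEqOnTreeInt` (c3s♭), `SplitKolyvaginDivOnTreeInt`,
  `SplitMuLambdaOnTreeInt` — the non-split ♭ predicates (p418462, p429473) VERBATIM with the sign flipped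
  (print status as their `R₀` twins: c2s = cas-split Thm. 2.10/2.11 at `a_p = +1`, PUB `p ≥ 5`, BDP
  currency, RULING L11 (O2) applies to any Literature filing; c3s = Keller–Yin Thm. D shape, PRE).
* §2 `bsdp_of_cellC_of_controlOnTreeAt_of_intHalves_of_partner` (ANY sign: ♭ halves at SOME frame +
  (CTL) at the datum + partner + PUB ⟹ `BSD(E,p)`) and the split road at a Heegner datum from PRINT
  (incl. Hsieh 2014 Thm. 1) + c2s♭ + c3s♭ + CTL-split + partner (`…_of_partner`, `…_of_mazurMainConjectureAt`), NO c1s.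
* §3 glue: c3s♭ ⟸ (c3s♭-div ∨ road H's sign-free `HidaLimitRevDivOnTreeInt`, p429473) ∧ c3s♭-μλ.

NOT: no proof of c2s♭ / c3s♭ / CTL-split; class level = `X2/SplitCellCClassInt.lean` (next file).
Refs: [Hsieh2014] Thm. 1; [Castella2018Exceptional] Thm. 2.10/2.11; [Castella2018] Thm. 2.3, §5;
[KellerYin2024] Thm. 5.1.3 (PRE); [CastellaEtAl2021] Thm. 5.3.1; memos cgshw MEMO-7/10, k5-c4 MEMO-1.
-/

set_option autoImplicit false

noncomputable section

open scoped Classical MatrixGroups ModularForm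

open CongruenceSubgroup WeierstrassCurve NumberField IsDedekindDomain Field PowerSeries
  Literature.NumberTheory.EllipticCurves Literature.NumberTheory.EllipticCurves.GreenbergSelmer
  Literature.NumberTheory.EllipticCurves.ModularForms
  Literature.NumberTheory.EllipticCurves.Rank1Residual
  Literature.NumberTheory.EllipticCurves.Rank1Residual.Typed
  Literature.NumberTheory.EllipticCurves.GreenbergVatsal2000
  Literature.NumberTheory.EllipticCurves.Wuthrich2014
  Literature.NumberTheory.EllipticCurves.SteinWuthrich2013
  Literature.NumberTheory.GaloisRepresentations Literature.NumberTheory.GaloisCohomology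
  Literature.NumberTheory.Automorphic
  Summit.BirchSwinnertonDyer.Rank1Residual.X11b.AcSelmer
  Summit.BirchSwinnertonDyer.Rank1Residual.X11b.Halves
  Summit.BirchSwinnertonDyer.Rank1Residual.X11b

namespace Summit.BirchSwinnertonDyer.Rank1Residual.X2
/-! ### §1 The split halves over the wide receptacle (hypothesis-shaped) -/

section HalvesInt

variable (W : WeierstrassCurve ℚ) [W.IsElliptic] [W.IsGloballyMinimal] (p : ℕ) [Fact p.Prime]

/-- **c2s♭ — `SplitBDPValueOnTreeInt W p`: the BDP VALUE half at a SPLIT X2c Heegner datum over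
`𝓞_{ℂ_p}`-frames** (the body of k5-c4's `NonsplitBDPValueOnTreeInt`, p418462, with the sign flipped; the
♭ twin of cgshw g6's `SplitBDPValueOnTree`, p416318): for every ♭-frame `Q`,
`Q(𝟙) = u·((1 − a_p(E)p⁻¹)·log_{ω_E} P)²`, `‖u‖ = 1` (`R1.BDPValueAtOneIntAt`; at a split `p`, `a_p = +1`
and the Euler factor is the exceptional one). PRINT: Castella JIMJ 17 (cas-split) Thm. 2.10/2.11 at
`a_p = +1`, PUB `p ≥ 5`, in BDP currency for Castella's frame (a Literature filing must type the printed
display and prove the rescaling — RULING L11 (O2)); NOT in print at `p = 3 ‖ N`. TYPED, not attempted;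
nothing asserted; consumed as a hypothesis.
[cite: Castella2018Exceptional, Thm. 2.10 and Thm. 2.11 (arXiv:1507.04260 p. 14) (printed value formula, p ≥ 5, either sign)]
[cite: Hsieh2014, Thm. 1 and p. 7 (arXiv:1112.1580) (the receptacle)] -/
@[conjecture]
def SplitBDPValueOnTreeInt : Prop :=
  ∀ (N : ℕ) [NeZero N] (K : Type) [Field K] [NumberField K] (Dt : ModularParametrizationData W N)
    (H : HeegnerDatum N (NumberField.discr K)) (ιK : K →+* ℂ) (P : (W.baseChange K).toAffine.Point),
    CellC W p → W.HasSplitMultiplicativeReductionAtPrime p → W.conductorNorm ℤ = N →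
    IsImaginaryQuadratic K → NumberField.discr K < -4 → SatisfiesHeegnerHypothesis N K →
    (W.quadraticTwist (NumberField.discr K : ℚ)).entireLFunction 1 ≠ 0 →
    WeierstrassCurve.Affine.Point.map ιK.toRatAlgHom P = heegnerPointComplex Dt H →
    ¬ (p : ℤ) ∣ Dt.c → ¬ IsOfFinAddOrder P →
    ∀ (κ : ZpExtension K p), κ.IsAnticyclotomic →
      ∀ (γ : Field.absoluteGaloisGroup K) [Fact (κ.IsTopGenerator γ)]
        (𝔭 : HeightOneSpectrum (𝓞 K)) (h𝔭 : ((p : ℕ) : 𝓞 K) ∈ 𝔭.asIdeal)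
        (he : 𝔭.asIdeal.ramificationIdx (𝓞 ℚ) = 1) (hf : 𝔭.asIdeal.inertiaDeg (𝓞 ℚ) = 1),
        ∀ (f : CuspForm (CongruenceSubgroup.Gamma0 N) 2), IsNewformOf W f →
          ∀ (ι' : PadicAlgCl p ≃+* ℂ),
            (∀ (w : InfinitePlace K) (k : 𝓞 K),
              k ∈ 𝔭.asIdeal ↔ ‖ι'.symm (w.embedding (k : K))‖ < 1) →
            ∀ (ΩK : ℂ) (Ωp : ℂ_[p]) (Q : PowerSeries 𝓞_ℂ_[p]), ΩK ≠ 0 → ‖Ωp‖ = 1 →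
              R1.IsBDPLFunctionInt p ι' 𝔭 κ γ f ΩK Ωp Q →
                R1.BDPValueAtOneIntAt W p (embAt K p 𝔭 h𝔭 he hf) P Q (W.LFunction p)

/-- **c3s♭ — `SplitIMCEqOnTreeInt W p`: the anticyclotomic IMC at a SPLIT X2c Heegner datum over
`𝓞_{ℂ_p}`-frames** (k5-c4's `NonsplitIMCEqOnTreeInt` with the sign flipped; ♭ twin of g6's
`SplitIMCEqOnTree`): `Ch_Λ(X_ac^∅(E[p^∞]))·𝓞_{ℂ_p}⟦T⟧ = (Q)` for every ♭-frame `Q`. PRINT: Keller–Yin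
Thm. D = v2 Thm. 5.1.3 (no sign hypothesis) — PREPRINT; in this cell = (c3s♭-div ∨ road H) ⊕ D′♭ (§3;
cgshw MEMO-8, MEMO-9, MEMO-10). NEVER a theorem here; every result using it is CONDITIONAL.
[claim: KellerYin2024, status: under-review]
[cite: KellerYin2024, Thm. 5.1.3 = Thm. D and §5.1 (arXiv:2402.12781v2), no sign hypothesis] -/
@[conjecture]
def SplitIMCEqOnTreeInt : Prop :=
  ∀ (N : ℕ) [NeZero N] (K : Type) [Field K] [NumberField K] (Dt : ModularParametrizationData W N)
    (H : HeegnerDatum N (NumberField.discr K)) (ιK : K →+* ℂ) (P : (W.baseChange K).toAffine.Point),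
    CellC W p → W.HasSplitMultiplicativeReductionAtPrime p → W.conductorNorm ℤ = N →
    IsImaginaryQuadratic K → NumberField.discr K < -4 → SatisfiesHeegnerHypothesis N K →
    (W.quadraticTwist (NumberField.discr K : ℚ)).entireLFunction 1 ≠ 0 →
    WeierstrassCurve.Affine.Point.map ιK.toRatAlgHom P = heegnerPointComplex Dt H →
    ¬ (p : ℤ) ∣ Dt.c → ¬ IsOfFinAddOrder P →
    ∀ (κ : ZpExtension K p), κ.IsAnticyclotomic →
      ∀ (γ : Field.absoluteGaloisGroup K) [Fact (κ.IsTopGenerator γ)]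
        (𝔭 : HeightOneSpectrum (𝓞 K)), ((p : ℕ) : 𝓞 K) ∈ 𝔭.asIdeal →
        𝔭.asIdeal.ramificationIdx (𝓞 ℚ) = 1 → 𝔭.asIdeal.inertiaDeg (𝓞 ℚ) = 1 →
        ∀ (f : CuspForm (CongruenceSubgroup.Gamma0 N) 2), IsNewformOf W f →
          ∀ (ι' : PadicAlgCl p ≃+* ℂ),
            (∀ (w : InfinitePlace K) (k : 𝓞 K),
              k ∈ 𝔭.asIdeal ↔ ‖ι'.symm (w.embedding (k : K))‖ < 1) →
            ∀ (ΩK : ℂ) (Ωp : ℂ_[p]) (Q : PowerSeries 𝓞_ℂ_[p]), ΩK ≠ 0 → ‖Ωp‖ = 1 →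
              R1.IsBDPLFunctionInt p ι' 𝔭 κ γ f ΩK Ωp Q →
                R1.IMCEqIntAt W p κ 𝔭 γ Q

/-- **c3s♭-div — `SplitKolyvaginDivOnTreeInt W p`**: ONE divisibility in the anticyclotomic IMC at a
SPLIT Eisenstein `p ‖ N` after inverting `p`, over `𝓞_{ℂ_p}`-frames (p429473's
`NonsplitKolyvaginDivOnTreeInt` with the sign flipped; provenance road R-β as for the `R₀` twin
`SplitKolyvaginDivOnTree`, p416318). TYPED, not attempted; nothing asserted.
[claim: Castella2024, status: under-review] [cite: CastellaGrossiSkinner2025, Thm. 5.5.1 (shape only; nothing asserted)] -/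
@[conjecture]
def SplitKolyvaginDivOnTreeInt : Prop :=
  ∀ (N : ℕ) [NeZero N] (K : Type) [Field K] [NumberField K] (Dt : ModularParametrizationData W N)
    (H : HeegnerDatum N (NumberField.discr K)) (ιK : K →+* ℂ) (P : (W.baseChange K).toAffine.Point),
    CellC W p → W.HasSplitMultiplicativeReductionAtPrime p → W.conductorNorm ℤ = N →
    IsImaginaryQuadratic K → NumberField.discr K < -4 → SatisfiesHeegnerHypothesis N K →
    (W.quadraticTwist (NumberField.discr K : ℚ)).entireLFunction 1 ≠ 0 →
    WeierstrassCurve.Affine.Point.map ιK.toRatAlgHom P = heegnerPointComplex Dt H →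
    ¬ (p : ℤ) ∣ Dt.c → ¬ IsOfFinAddOrder P →
    ∀ (κ : ZpExtension K p), κ.IsAnticyclotomic →
      ∀ (γ : Field.absoluteGaloisGroup K) [Fact (κ.IsTopGenerator γ)]
        (𝔭 : HeightOneSpectrum (𝓞 K)), ((p : ℕ) : 𝓞 K) ∈ 𝔭.asIdeal →
        𝔭.asIdeal.ramificationIdx (𝓞 ℚ) = 1 → 𝔭.asIdeal.inertiaDeg (𝓞 ℚ) = 1 →
        ∀ (f : CuspForm (CongruenceSubgroup.Gamma0 N) 2), IsNewformOf W f →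
          ∀ (ι' : PadicAlgCl p ≃+* ℂ),
            (∀ (w : InfinitePlace K) (k : 𝓞 K),
              k ∈ 𝔭.asIdeal ↔ ‖ι'.symm (w.embedding (k : K))‖ < 1) →
            ∀ (ΩK : ℂ) (Ωp : ℂ_[p]) (Q : PowerSeries 𝓞_ℂ_[p]), ΩK ≠ 0 → ‖Ωp‖ = 1 →
              R1.IsBDPLFunctionInt p ι' 𝔭 κ γ f ΩK Ωp Q →
                ∃ k : ℕ, PowerSeries.C ((p : 𝓞_ℂ_[p]) ^ k) * Q ∈
                  (XAc.charIdeal (W.baseChange K) p κ 𝔭 ∅ γ).map (PowerSeries.map (R1.toCpInt p))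

/-- **c3s♭-μλ — `SplitMuLambdaOnTreeInt W p`**: Keller–Yin D′ (`μ = 0` and `λ`-equality) at a SPLIT
Eisenstein `p ‖ N`, read in `𝓞_{ℂ_p}` (p429473's `NonsplitMuLambdaOnTreeInt` with the sign flipped; ♭
twin of g6's `SplitMuLambdaOnTree`). UNREFEREED PREPRINT; consumed as a hypothesis.
[claim: KellerYin2024, status: under-review]
[cite: KellerYin2024, Thm. 5.1.3 = Thm. D (arXiv:2402.12781v2 §5.1), the part D′ of its proof] -/
@[conjecture]
def SplitMuLambdaOnTreeInt : Prop :=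
  ∀ (N : ℕ) [NeZero N] (K : Type) [Field K] [NumberField K] (Dt : ModularParametrizationData W N)
    (H : HeegnerDatum N (NumberField.discr K)) (ιK : K →+* ℂ) (P : (W.baseChange K).toAffine.Point),
    CellC W p → W.HasSplitMultiplicativeReductionAtPrime p → W.conductorNorm ℤ = N →
    IsImaginaryQuadratic K → NumberField.discr K < -4 → SatisfiesHeegnerHypothesis N K →
    (W.quadraticTwist (NumberField.discr K : ℚ)).entireLFunction 1 ≠ 0 →
    WeierstrassCurve.Affine.Point.map ιK.toRatAlgHom P = heegnerPointComplex Dt H →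
    ¬ (p : ℤ) ∣ Dt.c → ¬ IsOfFinAddOrder P →
    ∀ (κ : ZpExtension K p), κ.IsAnticyclotomic →
      ∀ (γ : Field.absoluteGaloisGroup K) [Fact (κ.IsTopGenerator γ)]
        (𝔭 : HeightOneSpectrum (𝓞 K)), ((p : ℕ) : 𝓞 K) ∈ 𝔭.asIdeal →
        𝔭.asIdeal.ramificationIdx (𝓞 ℚ) = 1 → 𝔭.asIdeal.inertiaDeg (𝓞 ℚ) = 1 →
        ∀ (f : CuspForm (CongruenceSubgroup.Gamma0 N) 2), IsNewformOf W f →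
          ∀ (ι' : PadicAlgCl p ≃+* ℂ),
            (∀ (w : InfinitePlace K) (k : 𝓞 K),
              k ∈ 𝔭.asIdeal ↔ ‖ι'.symm (w.embedding (k : K))‖ < 1) →
            ∀ (ΩK : ℂ) (Ωp : ℂ_[p]) (Q : PowerSeries 𝓞_ℂ_[p]), ΩK ≠ 0 → ‖Ωp‖ = 1 →
              R1.IsBDPLFunctionInt p ι' 𝔭 κ γ f ΩK Ωp Q →
                ∀ F : IwasawaAlgebra p,
                  XAc.charIdeal (W.baseChange K) p κ 𝔭 ∅ γ = Ideal.span {F} →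
                  ∃ n : ℕ,
                    (‖((PowerSeries.coeff n (PowerSeries.map (R1.toCpInt p) F) : 𝓞_ℂ_[p]) : ℂ_[p])‖ = 1 ∧
                      ∀ i < n, ‖((PowerSeries.coeff i (PowerSeries.map (R1.toCpInt p) F) :
                        𝓞_ℂ_[p]) : ℂ_[p])‖ < 1) ∧
                    (‖((PowerSeries.coeff n Q : 𝓞_ℂ_[p]) : ℂ_[p])‖ = 1 ∧
                      ∀ i < n, ‖((PowerSeries.coeff i Q : 𝓞_ℂ_[p]) : ℂ_[p])‖ < 1)

end HalvesInt

/-! ### §2 SIGN-FREE pointwise assembly with ♭ halves and (CTL) as a hypothesis; the split road with NO c1s -/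

section AssemblyInt

variable (W : WeierstrassCurve ℚ) [W.IsElliptic] [W.IsGloballyMinimal] (p : ℕ) [Fact p.Prime]

/-- **ANY sign, wide receptacle: `BSD(E,p)` at a CGLS Heegner datum of a CellC pair FROM the control
input AT THE DATUM, the two ♭ halves at SOME `𝓞_{ℂ_p}`-frame `Q`, the partner's rank-zero `p`-part, and
PUBLISHED facts** — g6's `bsdp_of_cellC_of_controlOnTreeAt_of_halves_of_partner` (SplitHalvesAssembly)
VERBATIM with the halves step replaced by the receptacle's `X11b.R1.imcWaldspurgerOnTreeAt_of_intHalves`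
(as in k5-c4's `imcWaldspurgerOnTreeAt_of_intHalves_of_not_split_of_rankOne`, p420477, whose only use of
the sign is the control THEOREM; here (CTL) is the hypothesis `hCTL`). CONDITIONAL; nothing booked.
[cite: Castella2018, Thm. 2.3, Thm. 3.2 and §5 (5.1)–(5.3) (arXiv:1704.06608 pp. 5, 9, 12)]
[cite: CastellaEtAl2021, Thm. 5.3.1] [cite: Miller2011LMS, Def. 1.1] -/
theorem bsdp_of_cellC_of_controlOnTreeAt_of_intHalves_of_partner (hnf : exists_isNewformOf)
    (N : ℕ) [NeZero N] (K : Type) [Field K] [NumberField K]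
    (Dt : ModularParametrizationData W N) (H : HeegnerDatum N (NumberField.discr K)) (ι : K →+* ℂ)
    (P : (W.baseChange K).toAffine.Point)
    (hGZ : gross_zagier N W K) (hKo : kolyvagin N W K)
    (hGZK : rank_eq_analyticRank_of_analyticRank_le_one)
    (hc : CellC W p) (hN : W.conductorNorm ℤ = N) (hK : IsImaginaryQuadratic K)
    (hd4 : NumberField.discr K < -4) (hHN : SatisfiesHeegnerHypothesis N K)
    (hP : WeierstrassCurve.Affine.Point.map ι.toRatAlgHom P = heegnerPointComplex Dt H)
    (hcM : ¬ (p : ℤ) ∣ Dt.c)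
    (hLt : (W.quadraticTwist (NumberField.discr K : ℚ)).entireLFunction 1 ≠ 0)
    (Wd : WeierstrassCurve ℚ) [Wd.IsElliptic] [Wd.IsGloballyMinimal] (Cd : VariableChange ℚ)
    (hWd : Cd • W.quadraticTwist (NumberField.discr K : ℚ) = Wd) (htw : PPartRankZero Wd p)
    (htam : padicValNat p Wd.tamagawaProduct = padicValNat p W.tamagawaProduct)
    (hu : padicValRat p (Cd.u : ℚ) = 0)
    (htamK : padicValNat p (W.baseChange K).tamagawaProduct = 2 * padicValNat p W.tamagawaProduct)
    (κ : ZpExtension K p) (𝔭 : HeightOneSpectrum (𝓞 K)) (γ : absoluteGaloisGroup K)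
    [Fact (κ.IsTopGenerator γ)] (h𝔭 : ((p : ℕ) : 𝓞 K) ∈ 𝔭.asIdeal)
    (he : 𝔭.asIdeal.ramificationIdx (𝓞 ℚ) = 1) (hf : 𝔭.asIdeal.inertiaDeg (𝓞 ℚ) = 1)
    (hCTL : ControlOnTreeAt p κ 𝔭 γ (embAt K p 𝔭 h𝔭 he hf) P) (Q : PowerSeries 𝓞_ℂ_[p])
    (h3 : R1.IMCEqIntAt W p κ 𝔭 γ Q)
    (h2 : R1.BDPValueAtOneIntAt W p (embAt K p 𝔭 h𝔭 he hf) P Q (W.LFunction p)) : BSDp W p := by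
  have hmod : hasEntireLFunction_rat := hasEntireLFunction_rat_of_exists_isNewformOf hnf
  haveI : NeZero (W.conductorNorm ℤ) := ⟨(W.conductorNorm_pos_holds).ne'⟩
  obtain ⟨f, hfW⟩ := hnf W
  obtain ⟨n, hn, hne⟩ := hCTL
  have hIW : IMCWaldspurgerOnTreeAt p κ 𝔭 γ (embAt K p 𝔭 h𝔭 he hf) P :=
    R1.imcWaldspurgerOnTreeAt_of_intHalves hn h3 (R1.not_dvd_lFunction_of_mult hfW hc.2.2.2) h2
  obtain ⟨S, hIMC, hBDP, hCTL', hTAM⟩ :=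
    exists_shadowLinks_of_onTree_of_heegner p κ 𝔭 γ (embAt K p 𝔭 h𝔭 he hf) hN hHN hIW ⟨n, hn, hne⟩
  exact bsdp_of_cellC_of_indexIdentityAt W p N K Dt H ι P hGZ hKo hGZK hmod hc hK hd4 hHN hP hcM hLt
    Wd Cd hWd htw htam hu
    (fun hfin => by
      haveI := hfin
      exact indexIdentityAt_of_shadowLinks p S hIMC hBDP hCTL' hTAM htamK)

/-- **O9 ∩ {SPLIT} at a Heegner datum FROM PRINT + c2s♭ + c3s♭ + CTL-split + the partner's rank-zero
`p`-part — NO c1s** (the ♭ twin of g6's `bsdp_of_cellC_of_split_of_hsieh2014_of_halvesOnTree_of_partner`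
with `hres : SplitHsiehFrameResidualAt W p` REMOVED): the frame is PRODUCED over the wide receptacle —
`ι₀ : ℚ̄_p ≃ ℂ` (Steinitz), the degree-one `𝔭` induced by `ι₀` or `ι₀ ∘ conj`
(`X11b.exists_datum_forall_mem_iff`), and Hsieh 2014 Thm. 1 (`hH`, PUB) ALONE gives `(Ω_K, Ω_p, Q)`
there (`exists_isBDPLFunctionInt_of_hsieh2014_of_classX2`, k5-c4 p418462, SIGN-FREE: λ-supply by the
tree theorem `X11b.lambdaSupplyAt`, no `R₀`-descent); c2s♭ (`h2`) / c3s♭ (`h3`) are instantiated at it,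
CTL-split (`hCTL`) at the datum. CONDITIONAL on every listed binder; nothing booked.
[cite: Hsieh2014, Thm. 1 (arXiv:1112.1580 pp. 3–4)] [claim: KellerYin2024, status: under-review]
[cite: Castella2018Exceptional, Thm. 2.11 (arXiv:1507.04260 p. 14)] [cite: Miller2011LMS, Def. 1.1] -/
theorem bsdp_of_cellC_of_split_of_hsieh2014_of_intHalvesOnTree_of_partner
    (hnf : exists_isNewformOf) (hH : hsieh2014_exists_anticyclotomicPAdicLFunction)
    (N : ℕ) [NeZero N] (K : Type) [Field K] [NumberField K]
    (Dt : ModularParametrizationData W N) (H : HeegnerDatum N (NumberField.discr K)) (ι : K →+* ℂ)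
    (P : (W.baseChange K).toAffine.Point)
    (hGZ : gross_zagier N W K) (hKo : kolyvagin N W K)
    (hGZK : rank_eq_analyticRank_of_analyticRank_le_one)
    (hc : CellC W p) (hs : W.HasSplitMultiplicativeReductionAtPrime p) (hN : W.conductorNorm ℤ = N)
    (hK : IsImaginaryQuadratic K) (hd4 : NumberField.discr K < -4)
    (hHN : SatisfiesHeegnerHypothesis N K) (hsplit : SatisfiesHeegnerHypothesis p K)
    (hP : WeierstrassCurve.Affine.Point.map ι.toRatAlgHom P = heegnerPointComplex Dt H)
    (hPinf : ¬ IsOfFinAddOrder P) (hcM : ¬ (p : ℤ) ∣ Dt.c)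
    (hLt : (W.quadraticTwist (NumberField.discr K : ℚ)).entireLFunction 1 ≠ 0)
    (Wd : WeierstrassCurve ℚ) [Wd.IsElliptic] [Wd.IsGloballyMinimal] (Cd : VariableChange ℚ)
    (hWd : Cd • W.quadraticTwist (NumberField.discr K : ℚ) = Wd) (htw : PPartRankZero Wd p)
    (htam : padicValNat p Wd.tamagawaProduct = padicValNat p W.tamagawaProduct)
    (hu : padicValRat p (Cd.u : ℚ) = 0)
    (htamK : padicValNat p (W.baseChange K).tamagawaProduct = 2 * padicValNat p W.tamagawaProduct)
    (κ : ZpExtension K p) (hκ : κ.IsAnticyclotomic) (γ : absoluteGaloisGroup K)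
    [Fact (κ.IsTopGenerator γ)] (𝔭 : HeightOneSpectrum (𝓞 K))
    (h𝔭 : ((p : ℕ) : 𝓞 K) ∈ 𝔭.asIdeal) (he : 𝔭.asIdeal.ramificationIdx (𝓞 ℚ) = 1)
    (hf : 𝔭.asIdeal.inertiaDeg (𝓞 ℚ) = 1)
    (h2 : SplitBDPValueOnTreeInt W p) (h3 : SplitIMCEqOnTreeInt W p) (hCTL : SplitControlOnTree W p) :
    BSDp W p := by
  subst hN
  obtain ⟨f, hfW⟩ := hnf W
  obtain ⟨ι₀⟩ := PadicAlgCl.nonempty_ringEquiv_complex p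
  obtain ⟨ι', -, hι'⟩ := X11b.exists_datum_forall_mem_iff p ι₀ hK h𝔭
  have hγ : κ.IsTopGenerator γ := Fact.out
  obtain ⟨ΩK, Ωp, Q, hΩK, hΩp, hQ⟩ := exists_isBDPLFunctionInt_of_hsieh2014_of_classX2 W p hH ι' 𝔭 κ γ
    hfW hc.2 rfl hK hHN h𝔭 hι' hκ hγ
  exact bsdp_of_cellC_of_controlOnTreeAt_of_intHalves_of_partner W p hnf (W.conductorNorm ℤ) K Dt H ι
    P hGZ hKo hGZK hc rfl hK hd4 hHN hP hcM hLt Wd Cd hWd htw htam hu htamK κ 𝔭 γ h𝔭 he hf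
    (hCTL K P hc hs hK hsplit hLt hPinf κ hκ γ 𝔭 h𝔭 he hf) Q
    (h3 (W.conductorNorm ℤ) K Dt H ι P hc hs rfl hK hd4 hHN hLt hP hcM hPinf κ hκ γ 𝔭 h𝔭 he hf f
      hfW ι' hι' ΩK Ωp Q hΩK hΩp hQ)
    (h2 (W.conductorNorm ℤ) K Dt H ι P hc hs rfl hK hd4 hHN hLt hP hcM hPinf κ hκ γ 𝔭 h𝔭 he hf f
      hfW ι' hι' ΩK Ωp Q hΩK hΩp hQ)

/-- **The same with the partner's input in MAIN-CONJECTURE form** (`PPartRankZero Wd p` derived from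
`X2.MazurMainConjectureAt Wd p` — crux 3 ∩ split at the CGLS twist — exactly as in g6's
`bsdp_of_cellC_of_split_of_hsieh2014_of_halvesOnTree_of_mazurMainConjectureAt`). CONDITIONAL; nothing
booked. [cite: CastellaEtAl2021, Thm. 5.3.1 and its proof] [cite: SteinWuthrich2013, Thm. 6.1]
[claim: KellerYin2024, status: under-review] [cite: Miller2011LMS, Def. 1.1] -/
theorem bsdp_of_cellC_of_split_of_hsieh2014_of_intHalvesOnTree_of_mazurMainConjectureAt
    (hJs : thm61_splitMultiplicative) (hJn : thm61_nonsplitMultiplicative)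
    (hHs : exists_isSplitMultCanonical) (hHn : exists_isMultCanonical)
    (hpar : nonempty_modularParametrizationData)
    (hGS : ∀ (W : WeierstrassCurve ℚ) [W.IsElliptic] [W.IsGloballyMinimal] (p : ℕ) [Fact p.Prime],
      greenberg_stevens (W := W) (p := p))
    (hnf : exists_isNewformOf) (hH : hsieh2014_exists_anticyclotomicPAdicLFunction)
    (N : ℕ) [NeZero N] (K : Type) [Field K] [NumberField K]
    (Dt : ModularParametrizationData W N) (H : HeegnerDatum N (NumberField.discr K)) (ι : K →+* ℂ)
    (P : (W.baseChange K).toAffine.Point)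
    (hGZ : gross_zagier N W K) (hKo : kolyvagin N W K)
    (hGZK : rank_eq_analyticRank_of_analyticRank_le_one)
    (hc : CellC W p) (hs : W.HasSplitMultiplicativeReductionAtPrime p) (hN : W.conductorNorm ℤ = N)
    (hK : IsImaginaryQuadratic K) (hd4 : NumberField.discr K < -4)
    (hHN : SatisfiesHeegnerHypothesis N K) (hsplit : SatisfiesHeegnerHypothesis p K)
    (hP : WeierstrassCurve.Affine.Point.map ι.toRatAlgHom P = heegnerPointComplex Dt H)
    (hPinf : ¬ IsOfFinAddOrder P) (hcM : ¬ (p : ℤ) ∣ Dt.c)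
    (hLt : (W.quadraticTwist (NumberField.discr K : ℚ)).entireLFunction 1 ≠ 0)
    (Wd : WeierstrassCurve ℚ) [Wd.IsElliptic] [Wd.IsGloballyMinimal] (Cd : VariableChange ℚ)
    (hWd : Cd • W.quadraticTwist (NumberField.discr K : ℚ) = Wd)
    (hMC : MazurMainConjectureAt Wd p)
    (htam : padicValNat p Wd.tamagawaProduct = padicValNat p W.tamagawaProduct)
    (hu : padicValRat p (Cd.u : ℚ) = 0)
    (htamK : padicValNat p (W.baseChange K).tamagawaProduct = 2 * padicValNat p W.tamagawaProduct)
    (κ : ZpExtension K p) (hκ : κ.IsAnticyclotomic) (γ : absoluteGaloisGroup K)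
    [Fact (κ.IsTopGenerator γ)] (𝔭 : HeightOneSpectrum (𝓞 K))
    (h𝔭 : ((p : ℕ) : 𝓞 K) ∈ 𝔭.asIdeal) (he : 𝔭.asIdeal.ramificationIdx (𝓞 ℚ) = 1)
    (hf : 𝔭.asIdeal.inertiaDeg (𝓞 ℚ) = 1)
    (h2 : SplitBDPValueOnTreeInt W p) (h3 : SplitIMCEqOnTreeInt W p) (hCTL : SplitControlOnTree W p) :
    BSDp W p := by
  have hmod : hasEntireLFunction_rat := hasEntireLFunction_rat_of_exists_isNewformOf hnf
  have hC : Cd⁻¹ • Wd = W.quadraticTwist (NumberField.discr K : ℚ) := by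
    rw [← hWd, inv_smul_smul]
  have hXd : ClassX2 Wd p := classX2_twist W p hc.2 K hK hsplit Wd ⟨Cd⁻¹, hC⟩
  have hLd : Wd.entireLFunction 1 ≠ 0 := by
    rw [← Wd.entireLFunction_smul Cd⁻¹, hC]
    exact hLt
  have hrd : Wd.analyticRank = 0 := analyticRank_eq_zero_of_entireLFunction_one_ne_zero hLd
  have htw : PPartRankZero Wd p :=
    pPartRankZero_of_pPart hGZK Wd p hrd
      (pPart_of_bsdp hmod hGZK Wd p (by omega)
        (bsdp_of_mazurMainConjectureAt_of_analyticRank_eq_zero hJs hJn hHs hHn hGZK hmod hpar Wd p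
          (hGS Wd p) hXd.1 hXd.2.2 hrd hMC))
  exact bsdp_of_cellC_of_split_of_hsieh2014_of_intHalvesOnTree_of_partner W p hnf hH N K Dt H ι P hGZ
    hKo hGZK hc hs hN hK hd4 hHN hsplit hP hPinf hcM hLt Wd Cd hWd htw htam hu htamK κ hκ γ 𝔭 h𝔭 he hf
    h2 h3 hCTL

end AssemblyInt

/-! ### §3 Glue for the IMC atom at the SPLIT sign over the wide receptacle -/

section GlueInt

variable {W : WeierstrassCurve ℚ} [W.IsElliptic] [W.IsGloballyMinimal] {p : ℕ} [Fact p.Prime]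

omit [W.IsElliptic] [W.IsGloballyMinimal] in
/-- **c3s♭ from its Kolyvagin halves**: c3s♭-div + c3s♭-μλ ⟹ `SplitIMCEqOnTreeInt W p`
(`CpIntSeries.span_singleton_eq_of_C_pow_mul_mem`, p420633). CONDITIONAL; nothing booked.
[cite: KellerYin2024, proof of Thm. 3.0.8 (the closing by μ = 0 and λ)] [cite: Washington1997, §7.1 Prop. 7.2] -/
theorem splitIMCEqOnTreeInt_of_divInt_of_muLambdaInt (hdiv : SplitKolyvaginDivOnTreeInt W p)
    (hml : SplitMuLambdaOnTreeInt W p) : SplitIMCEqOnTreeInt W p := by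
  intro N _ K _ _ Dt H ιK P hc hs hN hK hd4 hHN hLt hP hcM hPinf κ hκ γ _ 𝔭 h𝔭 he hf f hfW ι' hι'
    ΩK Ωp Q hΩK hΩp hQ
  obtain ⟨k, hk⟩ := hdiv N K Dt H ιK P hc hs hN hK hd4 hHN hLt hP hcM hPinf κ hκ γ 𝔭 h𝔭 he hf f
    hfW ι' hι' ΩK Ωp Q hΩK hΩp hQ
  obtain ⟨F, hF⟩ :=
    (charIdeal_isPrincipal_holds p (XAc (W.baseChange K) p κ 𝔭 ∅ γ)).principal
  have hchar : XAc.charIdeal (W.baseChange K) p κ 𝔭 ∅ γ = Ideal.span {F} := hF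
  obtain ⟨n, hFn, hQn⟩ := hml N K Dt H ιK P hc hs hN hK hd4 hHN hLt hP hcM hPinf κ hκ γ 𝔭 h𝔭 he
    hf f hfW ι' hι' ΩK Ωp Q hΩK hΩp hQ F hchar
  unfold R1.IMCEqIntAt
  rw [hchar, Ideal.map_span, Set.image_singleton] at hk ⊢
  exact CpIntSeries.span_singleton_eq_of_C_pow_mul_mem hk hFn hQn

omit [W.IsElliptic] [W.IsGloballyMinimal] in
/-- **Road H closes c3s♭**: `HidaLimitRevDivOnTreeInt` (sign-free, p429473) + c3s♭-μλ ⟹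
`SplitIMCEqOnTreeInt W p` — the same algebra with the roles of `F♭` and `Q` exchanged. CONDITIONAL;
nothing booked. [cite: KellerYin2024, Lemma 5.1.2 and proof of Thm. 3.0.8 (arXiv:2402.12781v2)]
[cite: Washington1997, §7.1 Prop. 7.2] -/
theorem splitIMCEqOnTreeInt_of_hidaLimitRevDivInt_of_muLambdaInt (hrev : HidaLimitRevDivOnTreeInt W p)
    (hml : SplitMuLambdaOnTreeInt W p) : SplitIMCEqOnTreeInt W p := by
  intro N _ K _ _ Dt H ιK P hc hs hN hK hd4 hHN hLt hP hcM hPinf κ hκ γ _ 𝔭 h𝔭 he hf f hfW ι' hι'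
    ΩK Ωp Q hΩK hΩp hQ
  obtain ⟨F, hF⟩ :=
    (charIdeal_isPrincipal_holds p (XAc (W.baseChange K) p κ 𝔭 ∅ γ)).principal
  have hchar : XAc.charIdeal (W.baseChange K) p κ 𝔭 ∅ γ = Ideal.span {F} := hF
  obtain ⟨a, ha⟩ := hrev N K Dt H ιK P hc hN hK hd4 hHN hLt hP hcM hPinf κ hκ γ 𝔭 h𝔭 he hf f hfW
    ι' hι' ΩK Ωp Q hΩK hΩp hQ F hchar
  obtain ⟨n, hFn, hQn⟩ := hml N K Dt H ιK P hc hs hN hK hd4 hHN hLt hP hcM hPinf κ hκ γ 𝔭 h𝔭 he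
    hf f hfW ι' hι' ΩK Ωp Q hΩK hΩp hQ F hchar
  unfold R1.IMCEqIntAt
  rw [hchar, Ideal.map_span, Set.image_singleton]
  exact (CpIntSeries.span_singleton_eq_of_C_pow_mul_mem ha hQn hFn).symm

omit [W.IsElliptic] [W.IsGloballyMinimal] in
/-- **Either divisibility half suffices at the split sign too**: `(c3s♭-div ∨ HidaLimitRevDivInt) ∧
c3s♭-μλ ⟹ c3s♭`. CONDITIONAL; nothing booked. [folklore] -/
theorem splitIMCEqOnTreeInt_of_divInt_or_hidaLimitRevDivInt_of_muLambdaInt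
    (hdiv : SplitKolyvaginDivOnTreeInt W p ∨ HidaLimitRevDivOnTreeInt W p)
    (hml : SplitMuLambdaOnTreeInt W p) : SplitIMCEqOnTreeInt W p := by
  rcases hdiv with hd | hrev
  · exact splitIMCEqOnTreeInt_of_divInt_of_muLambdaInt hd hml
  · exact splitIMCEqOnTreeInt_of_hidaLimitRevDivInt_of_muLambdaInt hrev hml

end GlueInt

end Summit.BirchSwinnertonDyer.Rank1Residual.X2

end
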